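import Literature.AnabelianGeometry.EtaleTheta.FrobenioidMonoThetaSchemaNegative
import Literature.AnabelianGeometry.EtaleTheta.Discharge.Sec5BiThetaIso

/-!
# [EtTh] §5 ↔ §2 dictionary of Lemma 5.9 (iv): the hypothesis list of `envIsoBiTheta_of` is JOINTLY
# SATISFIABLE at a closed datum with NON-TRIVIAL cyclotomic character (PROOF-ONLY; pp. 331–332 / PDF pp. 105–106)

Mochizuki, *The étale theta function and its Frobenioid-theoretic manifestations*, Publ. RIMS **45**
(2009) [cite: MochizukiEtTh2009, Lem 5.8 proof p.105 (PRIMS p.331); Prop 5.2 (iii) p.98 (PRIMS p.324);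
Lem 5.9 (iv) p.106 (PRIMS p.332)].  abc-iut cell, block F, seat abc-iut-f-116 (gen 2), tranche 116 of
`plan/F-TRANCHES.tsv` (rows F-1306 `CyclotomicCharacterCompatX`, F-0521 `ThetaSectionCompat`, F-0520
`KummerOutReached` of abc-iut-L2-t11's `Discharge/Sec5EnvelopeTopology.lean`).  PROOF-ONLY companion
(0 `def`, 0 `instance`, 0 named `Prop` fact; nothing landed is edited) — the POSITIVE twin of this seat's
`Sec5EnvelopeTopologyClosures.lean` (gen 0), where the universal closures of the three rows are refuted.

WHAT IS PROVED.  The consumers of the three dictionary rows (abc-iut-L2-t11's `envIsoBiTheta_of`,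
`frdIsMonoThetaEnv_of'` — Lemma 5.9 (iv) discharged MODULO `Facts`, `IdentifiesPiY`, `IdentifiesPiYdd`,
`CyclotomicCharacterCompatX`, `η ∈ η̈^Θ ∧ ThetaSectionCompat η`, `ConstOutTransported`, `KummerOutReached`)
had not been verified TOGETHER at any closed datum of the tree (the closed §5 data landed so far —
abc-iut-f-115's degenerate `Sec5Toy.datum`, abc-iut-f-120's `Toy.toy₁/₂/₃`, this seat's abelian gen-0 toy —
serve refutations of universal closures).  Here the WHOLE hypothesis list is verified in the kernel at
abc-iut-f-120's closed NON-ABELIAN §5 toy `Toy.toy₃`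
(`FrobenioidMonoThetaSchemaNegative.lean`: `C := B(ℤ/3 ⋊ ℤˣ)` over `D := Bℤˣ`, `N = 3`,
`O^×(B_N) = μ_3(B_N) = ℤ/3` INVERTED by `s^⊓-gp_N(ρ g) = inr(sign(s3 g))`, constants `K := ℚ`) paired
with a NEW closed §2 datum `T` of level `3` over the same `Π^tp_X = ℤ × ℤ × 𝔖₃` whose Galois group is
`G_K := ℤˣ`, `Π^tp_X ↠ G_K := sign ∘ s3`, and whose character is the MATCHING inversion character
`χ := invAction` (non-trivial: `χ(aug g)` inverts `μ_3` at `g = (1, 1, (0 1)) ∈ Π^tp_Y̲`), `ι := id`,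
`m := muEquiv₃ : μ_3(B_N) ⥲ ℤ/3`:
* `facts_toy₃` — abc-iut-L2-t4's bundle `Facts` (p.330–331) HOLDS at `toy₃` (a closed datum with
  NON-ABELIAN `Aut_C(B_N)`; `sgpCapSection_toy₃`);
* `exists_dictionaryJointWitness` — there are `H : Facts`, `T`, `ι`, `m` with `IdentifiesPiY`,
  `IdentifiesPiYdd`, **`CyclotomicCharacterCompatX`** (F-1306; hence F-1307 `CyclotomicCharacterCompat`
  — contrast abc-iut-f-120's `toy₃_not_cyclotomicCharacterCompat`: the SAME §5 toy violates F-1307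
  against the §2 datum with TRIVIAL character for every `ι`, `m`; the dictionary PINS the character),
  `Fintype.card μ = 3` and `χ(aug(ι g)) x = x⁻¹` (non-degeneracy), **`ThetaSectionCompat`** for the theta
  cocycle `η := 1 ∈ η̈^Θ` (F-0521), **`ConstOutTransported`** and **`KummerOutReached` for `DK := ∅`**
  (F-0520; here `H¹(ℤˣ, ℤ/3(χ)) = 0`, so every Kummer shift is INNER — contrast gen 0's
  `not_forall_kummerOutReached`, where `DK := ∅` FAILS at the abelian toy with `H¹ ≠ 0`), and CONSEQUENTLY,
  by abc-iut-L2-t11's `envIsoBiTheta_of` and abc-iut-L2-t4's `frdIsMonoThetaEnv_of` BY NAME, abc-iut-L2-t4's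
  **F-0545 `EnvIsoBiTheta`** and **F-0546 `FrdIsMonoThetaEnv`** at this closed datum: the Lemma 5.9 (iv)
  discharge chain COMPOSES END-TO-END in the kernel on closed data with non-trivial cyclotomic character.
HONEST FRAMING: a consistency / non-vacuity witness for OUR typed hypothesis list; the toy is not the
genuine Tate-curve data and asserts nothing about [EtTh] (a refereed paper); typed ≠ proved; no side is
taken on [IUTchIII] Cor. 3.12.
-/

namespace Literature.AnabelianGeometry.EtaleTheta

open CategoryTheory
open Literature.AlgebraicGeometry.Frobenioids

namespace ThetaFrobenioid

namespace Toy

/-! ### Plumbing for `Aut_C(⋆)` in a one-object category -/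

/-- `(G ⥲ Aut ⋆)⁻¹` is `a ↦ a.hom` (plumbing for computing in `Aut_C(B_N)` of the toy data).
[cite: MochizukiEtTh2009, §5 p.331 (PDF p.105)] -/
theorem autEquiv_symm_apply {G : Type} [Group G] (a : Aut (SingleObj.star G)) :
    (autEquiv G).symm a = homOf G (SingleObj.star G) a :=
  (MulEquiv.symm_apply_eq _).mpr (Aut.ext rfl)

/-! ### Computations in `toy₃`: `Aut_C(B_N) = ℤ/3 ⋊ ℤˣ`, `O^×(B_N) = ℤ/3`, `s^⊓-gp_N(ρ g) = inr(sign(s3 g))` -/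

/-- `s^⊓-gp_N(ρ x) = inr(sign(s3 x))` in `toy₃` ("the composite of the natural outer homomorphism
`Π^tp_X ↠ Aut_D(B_N^bs)` with `s^⊓-gp_N`", Lemma 5.9 (iii)).  [cite: MochizukiEtTh2009, Lem 5.9 (iii) p.106 (PRIMS p.332)] -/
theorem homOf_sgpCap_rho_toy₃ (x : Pi) :
    homOf G₃ _ (toy₃.sgpCap (toy₃.ρ x)) = SemidirectProduct.inr (Equiv.Perm.sign (s3 x)) := by
  change homOf G₃ _ (autEquiv G₃ (SemidirectProduct.inr ((autEquiv ℤˣ).symm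
    (autEquiv ℤˣ (Equiv.Perm.sign (s3 x)))))) = _
  rw [MulEquiv.symm_apply_apply, homOf_autEquiv]

/-- A unit `u ∈ O^×(B_N)` of `toy₃` is `inl` of its `ℤ/3`-component. [cite: MochizukiEtTh2009, §5 p.331 (PDF p.105)] -/
theorem homOf_eq_inl_of_mem_units {u : Aut toy₃.BN} (hu : u ∈ toy₃.units toy₃.BN) :
    homOf G₃ _ u = SemidirectProduct.inl (homOf G₃ _ u).left := by
  have hr : (homOf G₃ _ u).right = 1 := (mem_unitsSubgroup_pre_iff π₃ _ u).mp hu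
  exact SemidirectProduct.ext (by rw [SemidirectProduct.left_inl]) (by rw [SemidirectProduct.right_inl, hr])

/-- Every unit of `toy₃` is `3`-torsion: `O^×(B_N) = μ_3(B_N) (= ℤ/3)`.  [cite: MochizukiEtTh2009, Def 5.4 p.101 (PRIMS p.327)] -/
theorem pow_three_eq_one_of_mem_units {u : Aut toy₃.BN} (hu : u ∈ toy₃.units toy₃.BN) :
    u ^ (3 : ℕ) = 1 := by
  have h3 : ∀ n : Multiplicative (ZMod 3), n ^ (3 : ℕ) = 1 := by decide
  apply homOf_injective G₃
  rw [map_pow, map_one, homOf_eq_inl_of_mem_units hu, ← map_pow, h3, map_one]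

/-- `O^×(B_N) ⊆ μ_3(B_N)` in `toy₃`. [cite: MochizukiEtTh2009, Def 5.4 p.101 (PRIMS p.327)] -/
theorem mem_muTorsion_of_mem_units {u : Aut toy₃.BN} (hu : u ∈ toy₃.units toy₃.BN) :
    u ∈ toy₃.muTorsion toy₃.BN toy₃.N :=
  ⟨hu, pow_three_eq_one_of_mem_units hu⟩

/-- **Conjugation by `s^⊓-gp_N(ρ x)` on the units of `toy₃` is the inversion action of `sign(s3 x) ∈ ℤˣ`**:
`s^⊓-gp_N(ρ x) · inl(n) · s^⊓-gp_N(ρ x)⁻¹ = inl(n^{sign(s3 x)})`.  [cite: MochizukiEtTh2009, Lem 5.8 proof p.105 (PRIMS p.331)] -/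
theorem homOf_conj_of_mem_units (x : Pi) {u : Aut toy₃.BN} (hu : u ∈ toy₃.units toy₃.BN) :
    homOf G₃ _ (toy₃.sgpCap (toy₃.ρ x) * u * (toy₃.sgpCap (toy₃.ρ x))⁻¹) =
      SemidirectProduct.inl (invAction (Multiplicative (ZMod 3)) (Equiv.Perm.sign (s3 x)) (homOf G₃ _ u).left) := by
  obtain ⟨n, hn⟩ : ∃ n, homOf G₃ _ u = SemidirectProduct.inl n := ⟨_, homOf_eq_inl_of_mem_units hu⟩
  rw [map_mul, map_mul, map_inv, homOf_sgpCap_rho_toy₃, hn, SemidirectProduct.left_inl,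
    SemidirectProduct.inl_aut, map_inv]

/-- `(β^bs)` of an automorphism `β` of `B_N` in `toy₃` is `π₃(β)` (the base functor is `Bπ₃`).
[cite: MochizukiEtTh2009, §5 p.331 (PDF p.105)] -/
theorem autBase_hom_toy₃ (a : Aut toy₃.BN) : (toy₃.autBase toy₃.BN a).hom = π₃ (homOf G₃ _ a) := rfl

/-- **`SgpCapSection` for `toy₃`**: `(s^⊓-gp_N(g))^bs = g` (`π₃ ∘ inr = id`). [cite: MochizukiEtTh2009, §5 p.331 (PDF p.105)] -/
theorem sgpCapSection_toy₃ : toy₃.SgpCapSection := by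
  intro b
  apply Aut.ext
  rw [autBase_hom_toy₃]
  change π₃ (SemidirectProduct.inr ((autEquiv ℤˣ).symm b)) = b.hom
  rw [SemidirectProduct.rightHom_inr, autEquiv_symm_apply]
  rfl

/-- The base-isomorphism `(s^⊓_N)^bs : A_N^bs ⥲ B_N^bs` of `toy₃` is the identity (`s^⊓_N = id`).
[cite: MochizukiEtTh2009, §5 p.331 (PDF p.105)] -/
theorem baseIsoAB_toy₃ : toy₃.baseIsoAB = Iso.refl _ :=
  Iso.ext (toy₃.base.map_id _)

/-- `Aut_D(A_N^bs) ⥲ Aut_D(B_N^bs)` of `toy₃` is the identity. [cite: MochizukiEtTh2009, §5 p.331 (PDF p.105)] -/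
theorem autBaseIsoAB_symm_apply_toy₃ (g : Aut (toy₃.base.obj toy₃.BN)) : toy₃.autBaseIsoAB.symm g = g := by
  rw [MulEquiv.symm_apply_eq]
  change g = toy₃.baseIsoAB.conjAut g
  rw [baseIsoAB_toy₃]
  exact (Aut.ext (by simp [Iso.conjAut_hom])).symm

/-- **abc-iut-L2-t4's bundle `Facts` of §5 named inputs HOLDS at `toy₃`** (`SgpCapSpec`, `SgpCupSpec`,
`StrvSection`, `BiKummerDifferenceMem`, `AutAmpleBN`, `ConstantsActByCyclotome`, `Epi s^⊓_N`, `Epi s^⊔_N`):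
the sections `s^trv_N = s^⊓-gp_N = s^⊔-gp_N` are induced by `inr : ℤˣ → ℤ/3 ⋊ ℤˣ`, so the bi-Kummer
difference cocycle is trivial; every unit is `3`-torsion, its `N`-th power `1` is a constant, and the
commutator of a unit with `s^⊓-gp_N(y)` is a unit — so Lemma 5.8's arithmetic step holds with
`(O_K^×)^{1/N} = O^×(B_N) = μ_3(B_N)` — a closed datum with NON-ABELIAN `Aut_C(B_N)` at which `Facts`
is verified.  [cite: MochizukiEtTh2009, §5 pp.330–331 (PDF pp.104–105)] -/
theorem facts_toy₃ : toy₃.Facts where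
  sgpCapSpec g := by
    rw [autBaseIsoAB_symm_apply_toy₃]
    change 𝟙 _ ≫ (toy₃.sgpCap g).hom = (toy₃.sgpCap g).hom ≫ 𝟙 _
    rw [Category.id_comp, Category.comp_id]
  sgpCupSpec h := by
    rw [autBaseIsoAB_symm_apply_toy₃]
    change 𝟙 _ ≫ (toy₃.sgpCap (h : Aut (toy₃.base.obj toy₃.BN))).hom =
      (toy₃.sgpCap (h : Aut (toy₃.base.obj toy₃.BN))).hom ≫ 𝟙 _
    rw [Category.id_comp, Category.comp_id]
  strvSection := sgpCapSection_toy₃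
  biKummerDifferenceMem h := by
    change toy₃.sgpCap (h : Aut (toy₃.base.obj toy₃.BN)) * (toy₃.sgpCap (h : Aut (toy₃.base.obj toy₃.BN)))⁻¹ ∈ _
    rw [mul_inv_cancel]
    exact one_mem _
  autAmpleBN g := ⟨toy₃.sgpCap g, sgpCapSection_toy₃ g⟩
  constantsActByCyclotome u := by
    constructor
    · intro hu
      have hu' : u ∈ toy₃.units toy₃.BN := toy₃.OKxRootN_le_units hu
      refine ⟨hu', fun y _ => mem_muTorsion_of_mem_units ?_⟩
      exact mul_mem ((toy₃.units_normal toy₃.BN).conj_mem u hu' (toy₃.sgpCap y)) (inv_mem hu')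
    · rintro ⟨hu, -⟩
      refine Subgroup.mem_map.mpr ⟨⟨u, hu⟩, ?_, rfl⟩
      rw [Subgroup.mem_comap, ThetaFrobenioid.mem_KxRootN, ← map_pow]
      have h1 : (⟨u, hu⟩ : toy₃.units toy₃.BN) ^ (toy₃.N : ℕ) = 1 :=
        Subtype.ext (pow_three_eq_one_of_mem_units hu)
      rw [h1, map_one]
      exact one_mem _
  epi_sCap := by change Epi (𝟙 _); infer_instance
  epi_sCup := by change Epi (𝟙 _); infer_instance

/-! ### The joint witness -/

/-- **The §5 ↔ §2 dictionary of Lemma 5.9 (iv) is jointly satisfiable, non-degenerately.**  At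
abc-iut-f-120's closed §5 toy `toy₃` (`Aut_C(B_N) = ℤ/3 ⋊ ℤˣ`, `μ_3(B_N) = ℤ/3` inverted by
`s^⊓-gp_N(ρ g)`, `sign(s3 g) = −1`) there are: the bundle `H : Facts`, a §2 datum `T` of level `3` over the
SAME `Π^tp_X = ℤ × ℤ × 𝔖₃` (`G_K := ℤˣ`, `aug := sign ∘ s3`, `μ := ℤ/3`, `χ := ` inversion, `η̈^Θ mod 3 := {1}`),
`ι := id`, `m := muEquiv₃`, such that ALL dictionary hypotheses of abc-iut-L2-t11's `envIsoBiTheta_of` hold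
— `IdentifiesPiY`, `IdentifiesPiYdd`, `CyclotomicCharacterCompatX` (F-1306; so F-1307), `ThetaSectionCompat`
for `η := 1 ∈ η̈^Θ` (F-0521), `ConstOutTransported` and `KummerOutReached` with `DK := ∅` (F-0520) — the
character being NON-TRIVIAL (`|μ| = 3`, `χ(aug(ι g))x = x⁻¹` at some `g ∈ Π^tp_Y̲`), and CONSEQUENTLY
abc-iut-L2-t4's `EnvIsoBiTheta` (F-0545) and `FrdIsMonoThetaEnv` (F-0546) hold at this closed datum: "the
natural inclusions `μ_N(B_N) ↪ E_N`, `Im(Π^tp_Y) ⊆ E_N` determine an isomorphism of topological groups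
`E^Π_N ⥲ Π^tp_Y[μ_N]` which is an isomorphism of mod `N` bi-theta environments" is REALISED in the kernel on
closed data with non-trivial cyclotomic character.  [cite: MochizukiEtTh2009, Lem 5.9 (iv) p.106 (PRIMS p.332)] -/
theorem exists_dictionaryJointWitness :
    letI : TopologicalSpace toy₃.PiX := toy₃.instTopPiX
    ∃ (H : toy₃.Facts) (T : ThetaEnvData.{0} toy₃.N) (ι : toy₃.PiX ≃ₜ* T.PiX)
      (m : toy₃.muTorsion toy₃.BN toy₃.N ≃* T.mu) (hY : toy₃.IdentifiesPiY T ι.toMulEquiv)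
      (hYdd : toy₃.IdentifiesPiYdd T ι.toMulEquiv) (hχX : toy₃.CyclotomicCharacterCompatX T ι.toMulEquiv m),
      toy₃.CyclotomicCharacterCompat T ι.toMulEquiv m ∧
      Fintype.card T.mu = 3 ∧
      (∃ g : toy₃.PiX, g ∈ toy₃.PiY ∧ ∀ x : T.mu, T.chi (T.aug (ι g)) x = x⁻¹) ∧
      (1 : T.PiYdd → T.mu) ∈ T.thetaCocycles ∧
      toy₃.ThetaSectionCompat H T ι.toMulEquiv m hYdd 1 ∧
      toy₃.ConstOutTransported H H.constantsEqNormalizer ∅ T ι m hY hχX.toY ∧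
      toy₃.KummerOutReached H H.sectionsFactor toy₃.outerActionLZ_of H.sgpCapSection H.sgpCupSection
        H.constantsEqNormalizer ∅ T ι m hY hχX.toY ∧
      toy₃.EnvIsoBiTheta H.sectionsFactor toy₃.outerActionLZ_of H.sgpCapSection H.sgpCupSection
        H.constantsEqNormalizer ∅ T ι ∧
      toy₃.FrdIsMonoThetaEnv H.sectionsFactor toy₃.outerActionLZ_of H.sgpCapSection H.sgpCupSection
        H.constantsEqNormalizer ∅ T := by
  -- the topologies: `Π` discrete, `μ_3 = ℤ/3` discrete
  letI tX : TopologicalSpace Pi := ⊥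
  haveI : DiscreteTopology Pi := ⟨rfl⟩
  haveI : IsTopologicalGroup Pi :=
    { continuous_mul := continuous_of_discreteTopology
      continuous_inv := continuous_of_discreteTopology }
  letI tμ : TopologicalSpace (Multiplicative (ZMod 3)) := ⊥
  haveI : DiscreteTopology (Multiplicative (ZMod 3)) := ⟨rfl⟩
  letI : TopologicalSpace toy₃.EPiN := toy₃.epinTopology
  -- `aug := sign ∘ s3 : Π ↠ ℤˣ` is onto and kills `Π^tp_Ÿ̲ = Ker ∩ s3⁻¹(𝔄₃)`
  have haug : Function.Surjective ((Equiv.Perm.sign).comp s3) := by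
    intro u
    obtain ⟨τ, hτ⟩ := Equiv.Perm.sign_surjective (Fin 3) u
    exact ⟨(1, (1, τ)), hτ⟩
  have hzq : Function.Surjective zq := fun z => ⟨(z, 1), rfl⟩
  have haugYdd : ∀ g : piYdd, Equiv.Perm.sign (s3 (g : Pi)) = 1 := fun g =>
    Equiv.Perm.mem_alternatingGroup.mp g.2.1
  -- the §2 datum
  let T : ThetaEnvData.{0} 3 :=
    { PiX := Pi
      G := ℤˣ
      aug := (Equiv.Perm.sign).comp s3
      aug_surjective := haug
      PiY := zq.ker
      PiY_normal := inferInstance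
      PiY_open := isOpen_discrete _
      galYX := QuotientGroup.quotientKerEquivOfSurjective zq hzq
      PiYdd := piYdd
      PiYdd_le := inf_le_right
      PiYdd_normal := inferInstance
      PiYdd_open := isOpen_discrete _
      index_PiYdd := toy₃.relindex_PiYdd
      mu := Multiplicative (ZMod 3)
      mu_cyclic := inferInstance
      card_mu := by simp [ZMod.card]
      chi := invAction (Multiplicative (ZMod 3))
      chi_ker_open := isOpen_discrete _
      thetaCocycles := {1}
      thetaCocycles_nonempty := Set.singleton_nonempty _
      isCocycle := by
        intro η hη g h
        rw [Set.mem_singleton_iff] at hη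
        subst hη
        simp
      locallyConstant := fun η _ => IsLocallyConstant.of_discrete η
      mul_coboundary_mem := by
        intro η hη c
        rw [Set.mem_singleton_iff] at hη ⊢
        subst hη
        funext g
        simp only [Pi.mul_apply, Pi.one_apply, one_mul]
        change c * (invAction (Multiplicative (ZMod 3)) (Equiv.Perm.sign (s3 (g : Pi))) c)⁻¹ = 1
        rw [haugYdd g, map_one, MulAut.one_apply, mul_inv_cancel] }
  have H : toy₃.Facts := facts_toy₃
  let ι : toy₃.PiX ≃ₜ* T.PiX := ContinuousMulEquiv.refl _
  let m : toy₃.muTorsion toy₃.BN toy₃.N ≃* T.mu := muEquiv₃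
  have hY : toy₃.IdentifiesPiY T ι.toMulEquiv := fun _ => Iff.rfl
  have hYdd : toy₃.IdentifiesPiYdd T ι.toMulEquiv := fun _ => Iff.rfl
  -- F-1306: conjugation by `s^⊓-gp_N(ρ g)` on `μ_3(B_N)` IS `χ(aug g)` under `m`
  have hχX : toy₃.CyclotomicCharacterCompatX T ι.toMulEquiv m := by
    intro g u u' hu'
    change (homOf G₃ _ (u' : Aut toy₃.BN)).left =
      invAction (Multiplicative (ZMod 3)) (Equiv.Perm.sign (s3 g)) (homOf G₃ _ (u : Aut toy₃.BN)).left
    rw [hu', homOf_conj_of_mem_units g u.2.1, SemidirectProduct.left_inl]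
  -- every unit is in `μ_3(B_N)`
  have hμ : ∀ v ∈ toy₃.units toy₃.BN, v ∈ toy₃.muTorsion toy₃.BN toy₃.N :=
    fun v hv => mem_muTorsion_of_mem_units hv
  -- F-0521 for `η := 1`: the bi-Kummer difference cocycle of `toy₃` is trivial
  have hcompat : toy₃.ThetaSectionCompat H T ι.toMulEquiv m hYdd 1 := by
    intro h
    have hd : toy₃.diffCocycle H h = 1 := by
      apply Subtype.ext
      change toy₃.sgpCap _ * (toy₃.sgpCap _)⁻¹ = 1
      exact mul_inv_cancel _
    rw [hd, map_one, Pi.one_apply, inv_one]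
  -- F-0520 with `DK := ∅`: every Kummer shift of `Π^tp_Y[μ_3]` is inner (`H¹(ℤˣ, ℤ/3(χ)) = 0`)
  have hKum : ∀ (δ : T.G → T.mu) (hδ : CycEnvelope.IsEnvCocycle T.augY T.chi (δ ∘ T.augY))
      (hc : CycEnvelope.shift hδ ∈ contMulAut T.env), TopOut.mk _ ⟨CycEnvelope.shift hδ, hc⟩ = 1 := by
    intro δ hδ hc
    have h1 : δ 1 = 1 := by
      have := hδ 1 1
      simp only [Function.comp_apply, mul_one, map_one, MulAut.one_apply] at this
      exact mul_eq_left.mp this.symm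
    have hsq : ∀ c : Multiplicative (ZMod 3), c⁻¹ * c⁻¹ = c := by decide
    set a : T.mu := (δ (-1))⁻¹ with ha
    have hfun : ∀ p : T.PiY, δ (T.augY p) = CycEnvelope.coboundary T.augY T.chi a p := by
      intro p
      rcases Int.units_eq_one_or (T.augY p) with hp | hp
      · rw [hp, h1]
        simp [CycEnvelope.coboundary, hp]
      · rw [hp]
        simp only [CycEnvelope.coboundary, hp]
        change δ (-1) = (δ (-1))⁻¹ * ((δ (-1))⁻¹ ^ (((-1 : ℤˣ) : ℤ)))⁻¹
        rw [Units.val_neg, Units.val_one, zpow_neg_one, inv_inv, hsq]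
    have hshift : CycEnvelope.shift hδ = MulAut.conj (CycEnvelope.inMu T.augY T.chi a) := by
      apply MulEquiv.ext
      intro x
      rw [CycEnvelope.conj_inMu_eq_shift_coboundary]
      refine SemidirectProduct.ext ?_ rfl
      change x.left * (δ ∘ T.augY) x.right = x.left * CycEnvelope.coboundary T.augY T.chi a x.right
      rw [Function.comp_apply, hfun]
    refine (QuotientGroup.eq_one_iff _).mpr ?_
    rw [Subgroup.mem_subgroupOf]
    exact ⟨CycEnvelope.inMu T.augY T.chi a, hshift.symm⟩
  have hK2 : toy₃.KummerOutReached H H.sectionsFactor toy₃.outerActionLZ_of H.sgpCapSection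
      H.sgpCupSection H.constantsEqNormalizer ∅ T ι m hY hχX.toY := by
    rintro o ⟨δ, hδ, hc, rfl⟩
    rw [hKum δ hδ hc]
    exact one_mem _
  -- the constants `(O_K^×)^{1/N} = μ_3(B_N)` act on `E^Π_N` by INNER automorphisms
  have hconst : ∀ (u : Aut toy₃.BN) (_ : u ∈ toy₃.units toy₃.BN)
      (hn : ((u, 1) : Aut toy₃.BN × toy₃.PiX) ∈
        Subgroup.normalizer (toy₃.EPiN : Set (Aut toy₃.BN × toy₃.PiX))), toy₃.conjOut ⟨(u, 1), hn⟩ = 1 := by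
    intro u hu hn
    refine (QuotientGroup.eq_one_iff _).mpr ?_
    rw [Subgroup.mem_subgroupOf]
    refine ⟨toy₃.muIncl ⟨u, hμ u hu⟩, ?_⟩
    apply MulEquiv.ext
    intro x
    apply Subtype.ext
    rfl
  have hK1 : toy₃.ConstOutTransported H H.constantsEqNormalizer ∅ T ι m hY hχX.toY := by
    rintro _ ⟨o, ho | ho, rfl⟩
    · obtain ⟨u, rfl⟩ := ho
      dsimp only
      rw [hconst _ (toy₃.OKxRootN_le_units u.2), map_one]
      exact one_mem _
    · exact ho.elim
  have hη : (1 : T.PiYdd → T.mu) ∈ T.thetaCocycles := Set.mem_singleton _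
  have hE := toy₃.envIsoBiTheta_of H H.sectionsFactor toy₃.outerActionLZ_of H.sgpCapSection
    H.sgpCupSection H.constantsEqNormalizer ∅ T ι m hY hYdd hχX hη hcompat hK1 hK2
  refine ⟨H, T, ι, m, hY, hYdd, hχX, hχX.toY,
    (by change Fintype.card (Multiplicative (ZMod 3)) = 3; rw [Fintype.card_multiplicative, ZMod.card]),
    ?_, hη, hcompat, hK1, hK2, hE,
    toy₃.frdIsMonoThetaEnv_of _ _ _ _ _ _ T ι hE⟩
  -- non-degeneracy: at `g = (1, 1, (0 1)) ∈ Π^tp_Y̲`, `χ(aug g)` inverts `μ_3`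
  refine ⟨(1, (1, Equiv.swap 0 1)), MonoidHom.mem_ker.mpr rfl, fun x => ?_⟩
  have hsign : Equiv.Perm.sign (s3 ((1, (1, Equiv.swap 0 1)) : Pi)) = -1 :=
    Equiv.Perm.sign_swap (show (0 : Fin 3) ≠ 1 by decide)
  change x ^ (((Equiv.Perm.sign (s3 ((1, (1, Equiv.swap 0 1)) : Pi))) : ℤ)) = x⁻¹
  rw [hsign, Units.val_neg, Units.val_one, zpow_neg_one]

end Toy

end ThetaFrobenioid

end Literature.AnabelianGeometry.EtaleTheta
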